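import Summits.Ventures.PercRepro.C026HubAttachD

/-!
# Hub attachment and the D-free inequality, V: the two offers through the hubs (p5, gen 10)

* **`hConnAvoid_ca_iff`** — `c ~_H a` avoiding `L` in `ω` iff `SigA` or `c ~_H a` avoiding `L₀` in
  the base (the witness of `SigA` never lies in `L`: `sigM_cluster_iff`; with `b ∈ L` the terminal
  lemma `rtg_sup_terminal_iff` degenerates to two terminals);
* **`hConnAvoid_cb_iff`** — symmetrically, by the `a ↔ b` swap (`IsHubSet.swap`, `isBot_swap`).
-/

namespace PercRepro

namespace MultiGraph

variable {V E : Type*} {G : MultiGraph V E}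

section Three

variable {Hs : Set V} {a b c : V} {ω : Config E} (hH : G.IsHubSet Hs a b c) (hbot : G.IsBot ω a b c)
include hH hbot

/-- The witness of `SigM a` never lies in `L`: the `X = L` and `X = ∅` versions agree. -/
theorem IsHubSet.sigM_cluster_iff :
    G.SigM Hs (G.cluster ω b) ω a c ↔ G.SigM Hs ∅ ω a c := by
  constructor
  · rintro ⟨h, hh, -, hcase⟩
    exact ⟨h, hh, fun h' => h', hcase⟩
  · rintro ⟨h, hh, -, hcase⟩
    refine ⟨h, hh, fun hL => ?_, hcase⟩
    have hob : G.OpenTo ω h b :=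
      (hH.hub_conn_mark_iff hbot hh (Or.inr (Or.inl rfl))).1 hL
    obtain ⟨h1, -, h3⟩ := hbot.singleDir (Hs := Hs) h hh
    rcases hcase with ⟨hoa, -⟩ | ⟨hoc, -⟩
    · exact h1 ⟨hoa, hob⟩
    · exact h3 ⟨hob, hoc⟩

/-- **`c ~_H a` avoiding `L` through the hubs**: in `ω` iff `SigA`, or `c ~_H a` avoiding `L₀` in
the base. -/
theorem IsHubSet.hConnAvoid_ca_iff :
    G.HConnAvoid ω c (G.cluster ω b) c a ↔
      G.SigM Hs ∅ ω a c ∨ G.HConnAvoid (G.baseOf Hs ω) c (G.cluster (G.baseOf Hs ω) b) c a := by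
  have hab := hbot.ne_ab
  have hac := hbot.ne_ac
  have hbc := hbot.ne_bc
  have ha : a ∉ Hs := hH.mark_notMem (Or.inl rfl)
  have hc : c ∉ Hs := hH.mark_notMem (Or.inr (Or.inr rfl))
  have hbotβ : G.IsBot (G.baseOf Hs ω) a b c := ((hH.isBot_iff_base ω).1 hbot).1
  set β := G.baseOf Hs ω with hβ
  set L := G.cluster ω b with hL
  set L₀ := G.cluster β b with hL₀
  have hLc : c ∉ L := fun h => hbot.2.2 (h : G.Conn ω b c)
  have hLa : a ∉ L := fun h => hbot.1 (h : G.Conn ω b a).symm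
  have hLb : b ∈ L := G.self_mem_cluster ω b
  have hL₀c : c ∉ L₀ := fun h => hbotβ.2.2 (h : G.Conn β b c)
  -- the two relations
  let S : V → V → Prop := fun u v => u ∉ Hs ∧ v ∉ Hs ∧ u ∉ L ∧ v ∉ L ∧ G.HAdj β c u v
  let Vr : V → V → Prop := fun u v => u ∉ L ∧ v ∉ L ∧
    ((G.SigM Hs L ω a c ∧ ((u = c ∧ v = a) ∨ (u = a ∧ v = c))) ∨
      (G.SigM Hs L ω b c ∧ ((u = c ∧ v = b) ∨ (u = b ∧ v = c))) ∨
        (G.SigLink Hs L ω a b c ∧ ((u = a ∧ v = b) ∨ (u = b ∧ v = a))))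
  have hS : ∀ u v, S u v → S v u := fun u v ⟨hu, hv, huL, hvL, h⟩ =>
    ⟨hv, hu, hvL, huL, G.hAdj_symm h⟩
  have hVr : ∀ u v, Vr u v → Vr v u := by
    rintro u v ⟨huL, hvL, h⟩
    refine ⟨hvL, huL, ?_⟩
    have sw : ∀ {p q r s : Prop}, (p ∧ q) ∨ (r ∧ s) → (s ∧ r) ∨ (q ∧ p) := fun h =>
      h.elim (fun ⟨h1, h2⟩ => Or.inr ⟨h2, h1⟩) (fun ⟨h1, h2⟩ => Or.inl ⟨h2, h1⟩)
    rcases h with ⟨hs, h⟩ | ⟨hs, h⟩ | ⟨hs, h⟩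
    · exact Or.inl ⟨hs, sw h⟩
    · exact Or.inr (Or.inl ⟨hs, sw h⟩)
    · exact Or.inr (Or.inr ⟨hs, sw h⟩)
  have hsupp : ∀ u v, Vr u v → (u = c ∨ u = a ∨ u = b) ∧ (v = c ∨ v = a ∨ v = b) := by
    rintro u v ⟨-, -, ⟨-, ⟨rfl, rfl⟩ | ⟨rfl, rfl⟩⟩ | ⟨-, ⟨rfl, rfl⟩ | ⟨rfl, rfl⟩⟩ |
      ⟨-, ⟨rfl, rfl⟩ | ⟨rfl, rfl⟩⟩⟩
    · exact ⟨Or.inl rfl, Or.inr (Or.inl rfl)⟩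
    · exact ⟨Or.inr (Or.inl rfl), Or.inl rfl⟩
    · exact ⟨Or.inl rfl, Or.inr (Or.inr rfl)⟩
    · exact ⟨Or.inr (Or.inr rfl), Or.inl rfl⟩
    · exact ⟨Or.inr (Or.inl rfl), Or.inr (Or.inr rfl)⟩
    · exact ⟨Or.inr (Or.inr rfl), Or.inr (Or.inl rfl)⟩
  have haug : ∀ u v, G.AugAdj Hs L ω a b c u v ↔ (S u v ∨ Vr u v) := fun u v => Iff.rfl
  -- the second disjunct of the terminal lemma is impossible: `b ∈ L`
  have hScb : ¬ Relation.ReflTransGen S c b := fun h =>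
    rtg_notMem_of_steps (fun _ _ hs => hs.2.2.2.1) h hbc.symm hLb
  have hVcb : ¬ Vr c b := fun h => h.2.1 hLb
  -- the base event
  have hSca : Relation.ReflTransGen S c a ↔ G.HConnAvoid β c L₀ c a := by
    rw [hH.hConnAvoid_base_iff hbot L₀ hL₀c (cluster_closed β b) hc ha]
    refine rtg_congr fun u v => ?_
    constructor
    · rintro ⟨hu, hv, huL, hvL, h⟩
      refine ⟨hu, hv, fun h' => huL ?_, fun h' => hvL ?_, h⟩
      · exact (hH.nonhub_conn_mark_iff hbot hu (Or.inr (Or.inl rfl))).2 h'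
      · exact (hH.nonhub_conn_mark_iff hbot hv (Or.inr (Or.inl rfl))).2 h'
    · rintro ⟨hu, hv, huL, hvL, h⟩
      refine ⟨hu, hv, fun h' => huL ?_, fun h' => hvL ?_, h⟩
      · exact (hH.nonhub_conn_mark_iff hbot hu (Or.inr (Or.inl rfl))).1 h'
      · exact (hH.nonhub_conn_mark_iff hbot hv (Or.inr (Or.inl rfl))).1 h'
  -- the virtual edge
  have hVca : Vr c a ↔ G.SigM Hs ∅ ω a c := by
    rw [← hH.sigM_cluster_iff hbot]
    constructor
    · rintro ⟨-, -, ⟨hs, -⟩ | ⟨-, ⟨-, h2⟩ | ⟨h1, -⟩⟩ | ⟨-, ⟨h1, -⟩ | ⟨h1, -⟩⟩⟩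
      · exact hs
      · exact (hab h2).elim
      · exact (hbc h1.symm).elim
      · exact (hac h1.symm).elim
      · exact (hbc h1.symm).elim
    · intro hs
      exact ⟨hLc, hLa, Or.inl ⟨hs, Or.inl ⟨rfl, rfl⟩⟩⟩
  rw [hH.hConnAvoid_iff_aug hbot (X := L) hLc (cluster_closed ω b) hc ha, rtg_congr haug,
    rtg_sup_terminal_iff hS hVr hsupp, hSca, hVca]
  constructor
  · rintro (h | ⟨h | h, -⟩)
    · exact h.symm
    · exact (hScb h).elim
    · exact (hVcb h).elim
  · intro h
    exact Or.inl h.symm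

/-- **`c ~_H b` avoiding `K` through the hubs**: in `ω` iff `SigB`, or `c ~_H b` avoiding `K₀` in
the base (the `a ↔ b` swap of `hConnAvoid_ca_iff`). -/
theorem IsHubSet.hConnAvoid_cb_iff :
    G.HConnAvoid ω c (G.cluster ω a) c b ↔
      G.SigM Hs ∅ ω b c ∨ G.HConnAvoid (G.baseOf Hs ω) c (G.cluster (G.baseOf Hs ω) a) c b :=
  hH.swap.hConnAvoid_ca_iff (G.isBot_swap hbot)


end Three

end MultiGraph

end PercRepro
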